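import Mathlib
import Summits.Ventures.PercRepro2.ZMeanProof
import Summits.Ventures.PercRepro2.PendantRoot
import Summits.Ventures.PercRepro2.A3LeafQuadratic
import Summits.Ventures.PercRepro2.HMFLeaf
import Summits.Ventures.PercRepro2.HMFPendantBEvents
import Summits.Ventures.PercRepro2.HMFPendantB
import Summits.Ventures.PercRepro2.HMFLeafStep
import Summits.Ventures.PercRepro2.HMFLeafIso

/-!
# The (HMF) leaf step: the first-order form and the closed form of the attachment coefficient
(blind cell PercRepro2, night-1 g7; NIGHT1-G7.md §1–§2)

Let `a₃` be a leaf with its only edge `f = {a₃, y}` of weight `q = p f` (`y` arbitrary).  By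
`HMFc_leaf_eq` and `HMFc_update_zero`,

  `HMFc(p) = q²·HMFc(p[f ↦ 1]) + q(1 − q)·(4 HMFc(p[f ↦ ½]) − HMFc(p[f ↦ 1]))`,

so (HMF) at the leaf follows from (HMF) at the contracted instance `p[f ↦ 1]` and the FIRST-ORDER
inequality `HMFc(1) ≤ 4·HMFc(½)` (`HMF_of_leaf_first_order`) — weaker than the concavity
`κ = 4 HMFc(½) − 2 HMFc(1) ≥ 0` of `HMF_of_leaf_step`, and implied by (HMF) on the leaf
instances themselves (take `q → 0`).

`kappa_eq` is the closed form of `κ`: with the five `f`-free masses `Z = P(Q)`,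
`A_L = P(Q, o ∈ C₁)`, `A_H`, `B_L = P(Q, b ∈ C₁)`, `B_H`, and the masses `D¹ = P(PD)`,
`D_o¹`, `W¹ = M₂ + Δ_T`, `X̂¹`, `S₃¹ = E_Q[σ₃]`, `S₃o¹ = E_Q[σ₃ 1_{o∈U}]` of the CONTRACTED instance,

  `κ = 2Z (A_L + A_H − D_o¹)(W¹ − B_H) + 2 (Z − D¹)(A_L B_H + A_H B_L − Z X̂¹)
       + (B_H − B_L) [(A_L + A_H − D_o¹) S₃¹ − (Z − D¹) S₃o¹]`

— i.e. `κ = −Q₂(v¹ − v⁰)` for the quadratic part `Q₂` of `HMFc` as a polynomial in the six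
varying masses, evaluated on the increment from the isolated instance (`v⁰`: `D = Z`,
`D_o = A_L + A_H`, `W = B_H`, `Z X̂ = A_L B_H + A_H B_L`, `S₃ = S₃o = 0`) to the contracted one.
Reading (NIGHT1-G7.md §2): `Z − D¹ = P(Q, y ∈ U)`, `A_L + A_H − D_o¹ = P(Q, o ∈ U, y ∈ U)`,
`B_H − W¹ = P(Q, y ∈ U, b opposite to y)`, and `A_L B_H + A_H B_L − Z X̂¹ = Z²` times the
Rao–Blackwell cross covariances of row 2′RB plus the `T/T′` mean-field terms, so `κ ≥ 0` (row
(ATT-y)) is a Rao–Blackwell statement along the cluster of `y`.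
-/

namespace Summit.Ventures.PercRepro2

open UnionCluster CovForm PendantRoot HMFPendantRoot HMFPendantB

namespace HMFLeafStep

variable {V : Type*} {E : Type*} [Fintype E] [DecidableEq E] [Fintype V] [DecidableEq V]
  {R : Type*} [Field R] [LinearOrder R] [IsStrictOrderedRing R]

variable (p : E → R) (ends : E → Sym2 V) {f : E} {a₃ y : V}

/-- **The (HMF) leaf step, first-order form**: `HMFc(p) = q² HMFc(1) + q(1 − q)(4 HMFc(½) − HMFc(1))`,
so (HMF) at a leaf `a₃` follows from (HMF) at the contracted instance and `HMFc(1) ≤ 4 HMFc(½)`. -/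
theorem HMF_of_leaf_first_order (hp : IsProbVec p) (hf : ends f = s(a₃, y))
    (hleaf : ∀ e, a₃ ∈ ends e → e = f) (h3y : a₃ ≠ y) {o a₁ a₂ b : V} (h31 : a₃ ≠ a₁) (h32 : a₃ ≠ a₂)
    (ho : o ≠ a₃) (hb : b ≠ a₃)
    (hcontract : 0 ≤ HMFc (Function.update p f 1) ends o a₁ a₂ a₃ b)
    (hfirst : HMFc (Function.update p f 1) ends o a₁ a₂ a₃ b ≤
      4 * HMFc (Function.update p f (1 / 2)) ends o a₁ a₂ a₃ b) :
    HMF p ends o a₁ a₂ a₃ b := by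
  unfold HMF
  have key := HMFc_leaf_eq p ends hf hleaf h3y h31 h32 (Ne.symm ho) (Ne.symm hb) (p f)
  rw [Function.update_eq_self] at key
  rw [key, HMFc_update_zero p ends hp hf hleaf h3y h31 h32 ho hb]
  have hq0 := hp.nonneg f
  have hq1 := sub_nonneg.2 (hp.le_one f)
  have h4 := sub_nonneg.2 hfirst
  nlinarith [mul_nonneg (mul_nonneg hq0 hq0) hcontract, mul_nonneg (mul_nonneg hq0 hq1) h4]

/-- **The closed form of the attachment coefficient** `κ = 4 HMFc(½) − 2 HMFc(1)` of a leaf `a₃`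
with any neighbour `y`, in the masses of the contracted instance `p[f ↦ 1]` and the five `f`-free
`Q`-masses (`κ = −Q₂(v¹ − v⁰)`, see the module docstring). -/
theorem kappa_eq (hp : IsProbVec p) (hf : ends f = s(a₃, y))
    (hleaf : ∀ e, a₃ ∈ ends e → e = f) (h3y : a₃ ≠ y) {o a₁ a₂ b : V} (h31 : a₃ ≠ a₁) (h32 : a₃ ≠ a₂)
    (ho : o ≠ a₃) (hb : b ≠ a₃) :
    4 * HMFc (Function.update p f (1 / 2)) ends o a₁ a₂ a₃ b -
        2 * HMFc (Function.update p f 1) ends o a₁ a₂ a₃ b =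
      2 * prob p (avoidAll ends a₂ {a₁}) *
          (prob p (avoidAll ends a₂ {a₁} ∩ connEvent ends a₁ o) +
              prob p (avoidAll ends a₂ {a₁} ∩ connEvent ends a₂ o) -
            Do (Function.update p f 1) ends o a₁ a₂ a₃) *
          (massM2 (Function.update p f 1) ends a₁ a₂ a₃ b +
              deltaT (Function.update p f 1) ends a₁ a₂ a₃ b -
            prob p (avoidAll ends a₂ {a₁} ∩ connEvent ends a₂ b)) +
        2 * (prob p (avoidAll ends a₂ {a₁}) -
              prob (Function.update p f 1) (PDEvent ends a₁ a₂ a₃)) *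
          (prob p (avoidAll ends a₂ {a₁} ∩ connEvent ends a₁ o) *
                prob p (avoidAll ends a₂ {a₁} ∩ connEvent ends a₂ b) +
              prob p (avoidAll ends a₂ {a₁} ∩ connEvent ends a₂ o) *
                prob p (avoidAll ends a₂ {a₁} ∩ connEvent ends a₁ b) -
            prob p (avoidAll ends a₂ {a₁}) * Xhat (Function.update p f 1) ends o a₁ a₂ a₃ b) +
        (prob p (avoidAll ends a₂ {a₁} ∩ connEvent ends a₂ b) -
            prob p (avoidAll ends a₂ {a₁} ∩ connEvent ends a₁ b)) *
          ((prob p (avoidAll ends a₂ {a₁} ∩ connEvent ends a₁ o) +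
                prob p (avoidAll ends a₂ {a₁} ∩ connEvent ends a₂ o) -
                Do (Function.update p f 1) ends o a₁ a₂ a₃) *
              EQ3 (Function.update p f 1) ends a₁ a₂ a₃ -
            (prob p (avoidAll ends a₂ {a₁}) -
                prob (Function.update p f 1) (PDEvent ends a₁ a₂ a₃)) *
              EQ3o (Function.update p f 1) ends o a₁ a₂ a₃) := by
  set p0 := Function.update p f 0 with hp0
  have hp0f : p0 f = 0 := by simp [hp0]
  have hpv0 : IsProbVec p0 := hp.update f le_rfl zero_le_one
  have h13 : a₁ ≠ a₃ := Ne.symm h31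
  have h23 : a₂ ≠ a₃ := Ne.symm h32
  have fc : ∀ {x z : V}, x ≠ a₃ → z ≠ a₃ → Free f (connEvent ends x z) :=
    fun hx hz => free_connEvent hf hleaf h3y hx hz
  have fQ : Free f (avoidAll ends a₂ {a₁}) := by
    rw [avoidAll_eq_compl]
    exact (fc h13 h23).compl
  have c₁o := fc h13 ho
  have c₂o := fc h23 ho
  have c₁b := fc h13 hb
  have c₂b := fc h23 hb
  -- constant blocks
  have hPQ : ∀ s : R, prob (Function.update p f s) (avoidAll ends a₂ {a₁}) =
      prob p (avoidAll ends a₂ {a₁}) := fun s => PendantEdm.prob_update_of_free p fQ s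
  have hEQo : ∀ s : R, EQo (Function.update p f s) ends o a₁ a₂ = EQo p ends o a₁ a₂ := by
    intro s
    simp only [EQo]
    rw [PendantEdm.prob_update_of_free p (fQ.inter c₁o) s,
      PendantEdm.prob_update_of_free p (fQ.inter c₂o) s]
  have hgap : ∀ s : R, gap (Function.update p f s) ends a₁ a₂ b = gap p ends a₁ a₂ b := by
    intro s
    simp only [gap]
    rw [PendantEdm.prob_update_of_free p c₂b s, PendantEdm.prob_update_of_free p c₁b s]
  -- affine blocks at `½`
  have hm : ∀ A : Set (Config E), prob (Function.update p f (1 / 2)) A =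
      (1 - 1 / 2) * prob p0 A + 1 / 2 * prob (Function.update p f 1) A :=
    fun A => A3Leaf.prob_update_mix p f A (1 / 2)
  have hX : Xhat (Function.update p f (1 / 2)) ends o a₁ a₂ a₃ b =
      (1 - 1 / 2) * Xhat p0 ends o a₁ a₂ a₃ b +
        1 / 2 * Xhat (Function.update p f 1) ends o a₁ a₂ a₃ b :=
    Xhat_update_mix p ends hf o a₁ a₂ b (1 / 2)
  -- the values at the isolated instance `p0`
  have hPD0 : ∀ X : Set (Config E), Free f X →
      prob p0 (PDEvent ends a₁ a₂ a₃ ∩ X) = prob p (avoidAll ends a₂ {a₁} ∩ X) := by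
    intro X hXf
    rw [prob_PD_inter_b p0 hf hleaf h3y h31 h32 hXf, hp0f, hp0,
      PendantEdm.prob_update_of_free p (fQ.inter hXf) 0]
    ring
  have hT0 : ∀ X : Set (Config E), Free f X → prob p0 (TEvent ends a₁ a₂ a₃ ∩ X) = 0 := by
    intro X hXf
    rw [prob_T_inter_b p0 hf hleaf h3y h31 h32 hXf, hp0f, zero_mul]
  have hT'0 : ∀ X : Set (Config E), Free f X → prob p0 (TEvent ends a₂ a₁ a₃ ∩ X) = 0 := by
    intro X hXf
    rw [prob_T'_inter_b p0 hf hleaf h3y h31 h32 hXf, hp0f, zero_mul]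
  have hPDu0 : prob p0 (PDEvent ends a₁ a₂ a₃) = prob p (avoidAll ends a₂ {a₁}) := by
    rw [prob_PD_b p0 ends hf hleaf h3y h31 h32, hp0f, hp0, PendantEdm.prob_update_of_free p fQ 0]
    ring
  have hTu0 : prob p0 (TEvent ends a₁ a₂ a₃) = 0 := by
    rw [prob_T_b p0 ends hf hleaf h3y h31 h32, hp0f, zero_mul]
  have hT'u0 : prob p0 (TEvent ends a₂ a₁ a₃) = 0 := by
    rw [prob_T'_b p0 ends hf hleaf h3y h31 h32, hp0f, zero_mul]
  -- `X̂` at `p0` is the isolated row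
  have hX0 : Xhat p0 ends o a₁ a₂ a₃ b = termW p0 ends o a₁ a₂ b {a₃} := by
    have h := Xhat_leaf_split p0 ends hf hleaf h3y o a₁ a₂ b
    have hopen : ∀ W : Finset V, prob p0 (clusterEvent ends y (↑W : Set V) ∩ openEdge f) = 0 := by
      intro W
      refine le_antisymm ?_ (prob_nonneg hpv0 _)
      calc prob p0 (clusterEvent ends y (↑W : Set V) ∩ openEdge f)
          ≤ prob p0 (openEdge f) := prob_mono hpv0 Set.inter_subset_right
        _ = 0 := by rw [prob_openEdge, hp0f]
    simp only [hopen, zero_mul, Finset.sum_const_zero, add_zero, hp0f, sub_zero, one_mul] at h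
    exact h
  have ht := termW_leaf_gen p0 ends hpv0 hf hleaf h3y h31 h32 ho hb
  rw [hp0, PendantEdm.prob_update_of_free p fQ 0, PendantEdm.prob_update_of_free p (fQ.inter c₁o) 0,
    PendantEdm.prob_update_of_free p (fQ.inter c₂b) 0, PendantEdm.prob_update_of_free p (fQ.inter c₂o) 0,
    PendantEdm.prob_update_of_free p (fQ.inter c₁b) 0] at ht
  -- expand and substitute
  simp only [HMFc, marginC, DEF, Do, EQ3, EQ3o, massM2, deltaT]
  simp only [hPQ, hEQo, hgap]
  rw [hX]
  simp only [hm]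
  rw [Set.inter_comm (connEvent ends a₂ b) (TEvent ends a₁ a₂ a₃),
    Set.inter_comm (connEvent ends a₁ b) (TEvent ends a₁ a₂ a₃)]
  simp only [hPD0 _ c₁o, hPD0 _ c₂o, hPD0 _ c₂b, hT0 _ c₁o, hT0 _ c₂o, hT0 _ c₁b, hT0 _ c₂b,
    hT'0 _ c₁o, hT'0 _ c₂o, hPDu0, hTu0, hT'u0, hX0]
  rw [gap_eq_Q]
  simp only [EQo]
  linear_combination (-2 * prob p (avoidAll ends a₂ {a₁}) -
    2 * prob (Function.update p f 1) (PDEvent ends a₁ a₂ a₃)) * ht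

end HMFLeafStep

end Summit.Ventures.PercRepro2
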